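import Summits.QuantumFields.GaugeBoot.ZdSchwingerDyson
import Summits.QuantumFields.GaugeBoot.ClassBHaarShift
import Literature.MathematicalPhysics.QuantumFieldTheory.Sweep1ShenZhuZhuProofs
import Literature.MathematicalPhysics.QuantumFieldTheory.StrongCouplingClustering
import HarnessLib

/-!
# The one-link Haar-shift identity AT ONE LINK, its differentiated form, and the free-boundary Wilson measure (gauge-boot, ADDENDUM 27 part M0)

HONEST FRAMING (cell `pub-gaugeboot`, page 1 of every file): the venture produces certified bounds
on lattice expectations at stated coupling, gauge group, dimension and torus size; NOT a mass gap,
NOT a continuum limit, NOT a string tension; NOT Yang–Mills-summit-bearing (barriers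
`FixedCouplingUltralocality`, `PerturbativeInvisibility`).  A structural statement about one-link integration by
parts; it certifies no number.

## Content

Third file of the lane's programme on the tree's NAMED FACT `Chatterjee2019LargeN.UnsymmetrizedMasterLoopEquation`
(Chatterjee, CMP 366 (2019), Theorem 8.1), whose measure is the FREE-boundary Wilson measure
`zdWilsonMeasure ρ β Λ` of a finite region `Λ ⊆ ℤ^d` (`Sweep1`) — not a Haar-shift state at every link (links near
or outside `Λ` see fewer plaquettes), but one at every link all of whose plaquettes lie in `Λ`, which is exactly
Chatterjee's hypothesis «all vertices at distance `≤ 1` from the loops are in `Λ`».  Hence the LOCAL notion: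

* `IsHaarShiftStateAt ρ β μ l` — the one-link Gibbs identity of `ClassB.IsHaarShiftState` at the single link `l`
  (`IsHaarShiftState.isHaarShiftStateAt`: the global notion is the local one at every link);
* ★ `IsHaarShiftStateAt.integral_shiftDeriv_eq` / `…_complex` — the DIFFERENTIATED identity `∫ f' dμ = β ∫ f S' dμ`
  along the left shift `U ↦ U[l ↦ k(t)U_l]` (verbatim the proof of `IsHaarShiftState.integral_shiftDeriv_eq` of
  `ZdSchwingerDyson.lean`, which only ever used the identity at `l`);
* ★ `isHaarShiftStateAt_zdWilsonMeasure` — for compact metrisable `G`, continuous `ρ`, every real `β`, every finite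
  `Λ` and every link `l` whose `2(d−1)` plaquettes have their corners in `Λ`, the free-boundary measure
  `zdWilsonMeasure ρ β Λ` is a Haar-shift state at `l`: the tree's DLR equation for the free measure
  (`integral_zdWilsonMeasure_eq_integral_integral_ymSpecification`, `Sweep1ShenZhuZhuProofs`) composed with the
  shift identity of the one-link kernel (`integral_shift_ymSpecification_singleton`, `ClassBHaarShift`).

References: H.-O. Georgii, *Gibbs Measures and Phase Transitions* (2011) Def. 2.9, Prop. 2.5; E. Seiler, LNP 159
(1982) Ch. 2; S. Chatterjee, Comm. Math. Phys. 366 (2019) §§5–8.  Everything is `[folklore]`.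
-/

noncomputable section

open MeasureTheory Filter Topology NormedSpace
open Literature.Probability.LatticeModels (Site)
open Literature.MathematicalPhysics.QuantumLattice (LGConfig ZdEdge ZdPlaquette IsCylinder wilsonBoundaryAction
  plaquettesTouching plaquetteEdges)
open Literature.MathematicalPhysics.QuantumFieldTheory (LatticeRep zdWilsonMeasure plaquettesIn
  isProbabilityMeasure_zdWilsonMeasure integral_zdWilsonMeasure_eq_integral_integral_ymSpecification)
open Summit.QuantumFields.YangMills.Theorems.EquipartitionPinsProbe.TangentSteinFiniteBeta
  (lipschitz_of_flow abs_exp_sub_exp_le exists_abs_le_of_continuous)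
open Summit.QuantumFields.YangMills.Theorems.EquipartitionPinsProbe.TangentDiffIdentity
  (hasDerivAt_integral_of_bounded_lipschitz)
open Summit.QuantumFields.YangMills.Cruxes.CurvatureAmnesia.WardDefect.SchwingerDyson (oneParam_neg)

namespace Summit.QuantumFields.GaugeBoot

variable {d N : ℕ} {G : Type} [Group G] [TopologicalSpace G] [IsTopologicalGroup G] [CompactSpace G]
  [MeasurableSpace G] [BorelSpace G]

/-! ### The local notion -/

section Local

variable (ρ : G →* Matrix (Fin N) (Fin N) ℂ)

/-- `μ` obeys the ONE-LINK HAAR-SHIFT (Gibbs) IDENTITY of the Wilson action at coupling `β` AT THE LINK `l`: for every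
`g ∈ G` and every continuous cylinder observable `f`,
`∫ f(U[l ↦ g·U_l]) dμ = ∫ f(U) · exp(-β (S_l(U[l ↦ g⁻¹·U_l]) - S_l(U))) dμ`, `S_l = wilsonBoundaryAction ρ {l}`
(the `l`-instance of `IsHaarShiftState`). [shape] A parametric definition of a proposition — NOT a fact. [folklore] -/
def IsHaarShiftStateAt (β : ℝ) (μ : Measure (LGConfig d G)) (l : ZdEdge d) : Prop :=
  ∀ (g : G) (f : LGConfig d G → ℝ) (S : Finset (ZdEdge d)),
    IsCylinder f S → Continuous f →
      ∫ U, f (Function.update U l (g * U l)) ∂μ =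
        ∫ U, f U * Real.exp (-(β * (wilsonBoundaryAction ρ {l} (Function.update U l (g⁻¹ * U l)) -
          wilsonBoundaryAction ρ {l} U))) ∂μ

omit [IsTopologicalGroup G] [CompactSpace G] [BorelSpace G] in
/-- A Haar-shift state is a Haar-shift state at every link. [folklore] -/
theorem IsHaarShiftState.isHaarShiftStateAt {β : ℝ} {μ : Measure (LGConfig d G)} (h : IsHaarShiftState ρ β μ)
    (l : ZdEdge d) : IsHaarShiftStateAt ρ β μ l :=
  fun g f S hf hfc => h l g f S hf hfc

omit [IsTopologicalGroup G] [CompactSpace G] [BorelSpace G] in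
/-- Conversely, Haar shift at every link is the global notion. [folklore] -/
theorem isHaarShiftState_of_forall {β : ℝ} {μ : Measure (LGConfig d G)} (h : ∀ l, IsHaarShiftStateAt ρ β μ l) :
    IsHaarShiftState ρ β μ :=
  fun l g f S hf hfc => h l g f S hf hfc

end Local

/-! ### The differentiated identity at one link -/

section Identity

variable [SecondCountableTopology G] (ρ : G →* Matrix (Fin N) (Fin N) ℂ)

/-- **One-link Schwinger–Dyson identity at the link `l`**: for compact second countable `G`, continuous `ρ`, a real
`β`, a finite measure `μ` with `IsHaarShiftStateAt ρ β μ l` and a multiplicative family `k : ℝ → G`: if the real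
cylinder observable `f` is continuous with a continuous derivative `f'` along `U ↦ U[l ↦ k(t)U_l]` at `t = 0`, and `S'`
is a continuous derivative of `wilsonBoundaryAction ρ {l}` along the same shift, then `∫ f' dμ = β ∫ f S' dμ`
(verbatim the proof of `IsHaarShiftState.integral_shiftDeriv_eq`). [folklore] -/
theorem IsHaarShiftStateAt.integral_shiftDeriv_eq (hρ : Continuous ρ) {β : ℝ} {μ : Measure (LGConfig d G)}
    [IsFiniteMeasure μ] {l : ZdEdge d} (hμ : IsHaarShiftStateAt ρ β μ l) {k : ℝ → G}
    (hk : ∀ s t, k (s + t) = k s * k t) (f f' : LGConfig d G → ℝ) {T₀ : Finset (ZdEdge d)}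
    (hfT : IsCylinder f T₀) (hf : Continuous f) (hf'c : Continuous f')
    (hf' : ∀ U, HasDerivAt (fun t => f (Function.update U l (k t * U l))) (f' U) 0)
    (S' : LGConfig d G → ℝ) (hS'c : Continuous S')
    (hS' : ∀ U, HasDerivAt (fun t => wilsonBoundaryAction ρ {l} (Function.update U l (k t * U l)))
      (S' U) 0) :
    ∫ U, f' U ∂μ = β * ∫ U, f U * S' U ∂μ := by
  -- adapted from `Summits/QuantumFields/GaugeBoot/ZdSchwingerDyson.lean` (the global version)
  set S := wilsonBoundaryAction (d := d) (G := G) ρ {l} with hSdef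
  set T : ℝ → LGConfig d G → LGConfig d G := fun t U => Function.update U l (k t * U l) with hT
  have hflow : ∀ s t U, T (t + s) U = T t (T s U) := fun s t U => TiltedRP.update_shift_flow hk l s t U
  have hT0 : ∀ U, T 0 U = U := fun U => TiltedRP.update_shift_zero hk l U
  have hTc : ∀ t, Continuous (T t) := fun t => TiltedRP.continuous_update_shift l (k t)
  have hf'T : ∀ U, HasDerivAt (fun t => f (T t U)) (f' U) 0 := hf'
  have hS'T : ∀ U, HasDerivAt (fun t => S (T t U)) (S' U) 0 := hS'
  obtain ⟨Cf, hCf0, hCf⟩ := exists_abs_le_of_continuous hf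
  obtain ⟨Cf', -, hCf'⟩ := exists_abs_le_of_continuous hf'c
  obtain ⟨CS', hCS'0, hCS'⟩ := exists_abs_le_of_continuous hS'c
  have hSc : Continuous S := by
    rw [hSdef]
    unfold wilsonBoundaryAction
    exact continuous_finsetSum _ fun p _ =>
      continuous_const.sub (TiltedRP.continuous_plaqObs ρ hρ (TiltedRP.zdUnit d) p)
  obtain ⟨CS, -, hCS⟩ := exists_abs_le_of_continuous hSc
  have hAB : ∀ t : ℝ, ∫ U, f (T t U) ∂μ = ∫ U, f U * Real.exp (-(β * (S (T (-t) U) - S U))) ∂μ := by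
    intro t
    have h := hμ (k t) f T₀ hfT hf
    rw [← oneParam_neg hk t] at h
    exact h
  have hAd : HasDerivAt (fun t : ℝ => ∫ U, f (T t U) ∂μ) (∫ U, f' U ∂μ) 0 := by
    refine hasDerivAt_integral_of_bounded_lipschitz μ (fun t U => f (T t U)) f' (Cf + Cf')
      (fun t => (hf.comp (hTc t)).measurable) hf'c.measurable
      (fun t U => (hCf _).trans (le_add_of_nonneg_right ?_)) (fun U t s => ?_) hf'T
    · exact (abs_nonneg _).trans (hCf' U)
    · calc |f (T t U) - f (T s U)| ≤ Cf' * |t - s| := lipschitz_of_flow T hflow f f' hf'T hCf' U t s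
        _ ≤ (Cf + Cf') * |t - s| := by gcongr; linarith [(abs_nonneg _).trans (hCf U)]
  have hBd : HasDerivAt (fun t : ℝ => ∫ U, f U * Real.exp (-(β * (S (T (-t) U) - S U))) ∂μ)
      (∫ U, f U * (β * S' U) ∂μ) 0 := by
    set M := |β| * (2 * CS) with hMdef
    have hM : ∀ t U, -(β * (S (T (-t) U) - S U)) ≤ M := fun t U => by
      have h1 := hCS (T (-t) U)
      have h2 := hCS U
      calc -(β * (S (T (-t) U) - S U)) ≤ |β * (S (T (-t) U) - S U)| := neg_le_abs _
        _ = |β| * |S (T (-t) U) - S U| := abs_mul _ _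
        _ ≤ |β| * (2 * CS) := by
            gcongr
            calc |S (T (-t) U) - S U| ≤ |S (T (-t) U)| + |S U| := abs_sub _ _
              _ ≤ CS + CS := add_le_add h1 h2
              _ = 2 * CS := by ring
    have hE : ∀ t U, |Real.exp (-(β * (S (T (-t) U) - S U)))| ≤ Real.exp M := fun t U => by
      rw [abs_of_pos (Real.exp_pos _)]
      exact Real.exp_le_exp.2 (hM t U)
    have hSlip : ∀ U t s, |S (T (-t) U) - S (T (-s) U)| ≤ CS' * |t - s| := fun U t s => by
      have h := lipschitz_of_flow T hflow S S' hS'T hCS' U (-t) (-s)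
      rwa [show |(-t) - (-s)| = |t - s| by rw [neg_sub_neg, abs_sub_comm]] at h
    refine hasDerivAt_integral_of_bounded_lipschitz μ
      (fun t U => f U * Real.exp (-(β * (S (T (-t) U) - S U)))) (fun U => f U * (β * S' U))
      (Cf * Real.exp M + Cf * (Real.exp M * (|β| * CS'))) (fun t => ?_) ?_ (fun t U => ?_)
      (fun U t s => ?_) (fun U => ?_)
    · exact (hf.mul (Real.continuous_exp.comp
        (((hSc.comp (hTc (-t))).sub hSc).const_mul β).neg)).measurable
    · exact (hf.mul (hS'c.const_mul β)).measurable
    · calc |f U * Real.exp (-(β * (S (T (-t) U) - S U)))|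
          = |f U| * |Real.exp (-(β * (S (T (-t) U) - S U)))| := abs_mul _ _
        _ ≤ Cf * Real.exp M := mul_le_mul (hCf U) (hE t U) (abs_nonneg _) hCf0
        _ ≤ Cf * Real.exp M + Cf * (Real.exp M * (|β| * CS')) := le_add_of_nonneg_right (by positivity)
    · have hx : -(β * (S (T (-t) U) - S U)) ≤ M := hM t U
      have hy : -(β * (S (T (-s) U) - S U)) ≤ M := hM s U
      calc |f U * Real.exp (-(β * (S (T (-t) U) - S U))) - f U * Real.exp (-(β * (S (T (-s) U) - S U)))|
          = |f U| * |Real.exp (-(β * (S (T (-t) U) - S U))) -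
              Real.exp (-(β * (S (T (-s) U) - S U)))| := by rw [← mul_sub, abs_mul]
        _ ≤ Cf * (Real.exp M * |(-(β * (S (T (-t) U) - S U))) - (-(β * (S (T (-s) U) - S U)))|) :=
            mul_le_mul (hCf U) (abs_exp_sub_exp_le hx hy) (abs_nonneg _) hCf0
        _ = Cf * (Real.exp M * (|β| * |S (T (-t) U) - S (T (-s) U)|)) := by
            rw [show -(β * (S (T (-t) U) - S U)) - -(β * (S (T (-s) U) - S U)) =
              -(β * (S (T (-t) U) - S (T (-s) U))) by ring, abs_neg, abs_mul]
        _ ≤ Cf * (Real.exp M * (|β| * (CS' * |t - s|))) := by gcongr; exact hSlip U t s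
        _ = Cf * (Real.exp M * (|β| * CS')) * |t - s| := by ring
        _ ≤ (Cf * Real.exp M + Cf * (Real.exp M * (|β| * CS'))) * |t - s| := by
            have : 0 ≤ Cf * Real.exp M * |t - s| := by positivity
            nlinarith [this]
    · have hSneg : HasDerivAt (fun t : ℝ => S (T (-t) U)) (-(S' U)) 0 := by
        have h0 : HasDerivAt (fun t : ℝ => S (T t U)) (S' U) (-0) := by rw [neg_zero]; exact hS'T U
        have h := h0.scomp (0 : ℝ) (hasDerivAt_neg (0 : ℝ))
        simpa [Function.comp_def] using h
      have hin : HasDerivAt (fun t : ℝ => -(β * (S (T (-t) U) - S U))) (β * S' U) 0 := by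
        exact (((hSneg.sub_const (S U)).const_mul β).neg).congr_deriv (by ring)
      have hexp := hin.exp
      have h0 : -(β * (S (T (-0) U) - S U)) = 0 := by rw [neg_zero, hT0, sub_self, mul_zero, neg_zero]
      rw [h0, Real.exp_zero, one_mul] at hexp
      exact hexp.const_mul (f U)
  have hEq : (fun t : ℝ => ∫ U, f (T t U) ∂μ) =
      fun t : ℝ => ∫ U, f U * Real.exp (-(β * (S (T (-t) U) - S U))) ∂μ := funext hAB
  rw [hEq] at hAd
  rw [hAd.unique hBd, ← integral_const_mul]
  refine integral_congr_ae (ae_of_all _ fun U => ?_)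
  ring

/-- **Complex-valued one-link Schwinger–Dyson identity at the link `l`** (real and imaginary parts of the previous
theorem; for a lattice representation `r`, which makes `G` second countable). [folklore] -/
theorem IsHaarShiftStateAt.integral_shiftDeriv_eq_complex (r : LatticeRep G) {β : ℝ} {μ : Measure (LGConfig d G)}
    [IsFiniteMeasure μ] {l : ZdEdge d} (hμ : IsHaarShiftStateAt r.ρ β μ l) {k : ℝ → G}
    (hk : ∀ s t, k (s + t) = k s * k t)
    (f f' : LGConfig d G → ℂ) {T₀ : Finset (ZdEdge d)} (hfT : IsCylinder f T₀) (hf : Continuous f)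
    (hf'c : Continuous f')
    (hf' : ∀ U, HasDerivAt (fun t => f (Function.update U l (k t * U l))) (f' U) 0)
    (S' : LGConfig d G → ℝ) (hS'c : Continuous S')
    (hS' : ∀ U, HasDerivAt (fun t => wilsonBoundaryAction r.ρ {l} (Function.update U l (k t * U l)))
      (S' U) 0) :
    ∫ U, f' U ∂μ = (β : ℂ) * ∫ U, f U * (S' U : ℂ) ∂μ := by
  -- adapted from `TiltedRP.integral_shiftDeriv_eq_complex` (`ZdSchwingerDyson.lean`)
  have hre := hμ.integral_shiftDeriv_eq r.ρ r.continuous hk (fun U => (f U).re)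
    (fun U => (f' U).re) (T₀ := T₀) (fun U V h => congrArg Complex.re (hfT h))
    (Complex.continuous_re.comp hf) (Complex.continuous_re.comp hf'c)
    (fun U => by simpa [Function.comp_def] using (Complex.reCLM.hasFDerivAt.comp_hasDerivAt (0 : ℝ) (hf' U)))
    S' hS'c hS'
  have him := hμ.integral_shiftDeriv_eq r.ρ r.continuous hk (fun U => (f U).im)
    (fun U => (f' U).im) (T₀ := T₀) (fun U V h => congrArg Complex.im (hfT h))
    (Complex.continuous_im.comp hf) (Complex.continuous_im.comp hf'c)
    (fun U => by simpa [Function.comp_def] using (Complex.imCLM.hasFDerivAt.comp_hasDerivAt (0 : ℝ) (hf' U)))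
    S' hS'c hS'
  have hi1 : Integrable f' μ := TiltedRP.integrable_of_continuous_zd r μ hf'c
  have hi2 : Integrable (fun U => f U * (S' U : ℂ)) μ :=
    TiltedRP.integrable_of_continuous_zd r μ (hf.mul (Complex.continuous_ofReal.comp hS'c))
  apply Complex.ext
  · have h1 := Complex.reCLM.integral_comp_comm hi1
    have h2 := Complex.reCLM.integral_comp_comm hi2
    simp only [Complex.reCLM_apply, Complex.mul_re, Complex.ofReal_re, Complex.ofReal_im, mul_zero,
      sub_zero] at h1 h2
    rw [← h1, hre, Complex.re_ofReal_mul, ← h2]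
  · have h1 := Complex.imCLM.integral_comp_comm hi1
    have h2 := Complex.imCLM.integral_comp_comm hi2
    simp only [Complex.imCLM_apply, Complex.mul_im, Complex.ofReal_re, Complex.ofReal_im, mul_zero,
      zero_add] at h1 h2
    rw [← h1, him, Complex.im_ofReal_mul, ← h2]

end Identity

/-! ### The free-boundary Wilson measure is a Haar-shift state at every link deep inside the region -/

section Free

variable [SecondCountableTopology G] (ρ : G →* Matrix (Fin N) (Fin N) ℂ)

/-- ★ **The free-boundary Wilson measure `μ_{Λ,β}` is a Haar-shift state at every link whose plaquettes lie in `Λ`**: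
for compact metrisable `G`, continuous `ρ`, every real `β`, every finite `Λ ⊆ ℤ^d` and every link `l` such that all
`2(d−1)` plaquettes through `l` have their four corners in `Λ`, `IsHaarShiftStateAt ρ β (zdWilsonMeasure ρ β Λ) l`.
Proof: the free measure satisfies the DLR equation for the single link `l` (tree
`integral_zdWilsonMeasure_eq_integral_integral_ymSpecification`) and the one-link kernel satisfies the shift identity
(tree `integral_shift_ymSpecification_singleton`). [folklore] -/
theorem isHaarShiftStateAt_zdWilsonMeasure (hρ : Continuous ρ) (β : ℝ) (Λ : Finset (Site d)) (l : ZdEdge d)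
    (hl : ∀ p ∈ plaquettesTouching ({l} : Finset (ZdEdge d)),
      ((p.1, p.2.1.1, p.2.1.2) : Site d × Fin d × Fin d) ∈ plaquettesIn Λ) :
    IsHaarShiftStateAt ρ β (zdWilsonMeasure ρ β Λ) l := by
  intro g f S _ hfc
  have hS : Continuous (wilsonBoundaryAction (G := G) ρ {l}) :=
    Literature.MathematicalPhysics.QuantumLattice.continuous_wilsonBoundaryAction ρ hρ _
  have h1c : Continuous fun U : LGConfig d G => f (Function.update U l (g * U l)) :=
    hfc.comp (continuous_update_mul l g)
  have hwc : Continuous fun U : LGConfig d G => Real.exp (-(β *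
      (wilsonBoundaryAction ρ {l} (Function.update U l (g⁻¹ * U l)) - wilsonBoundaryAction ρ {l} U))) :=
    Real.continuous_exp.comp ((((hS.comp (continuous_update_mul l g⁻¹)).sub hS).const_smul β).neg)
  have h2c : Continuous fun U : LGConfig d G => f U * Real.exp (-(β *
      (wilsonBoundaryAction ρ {l} (Function.update U l (g⁻¹ * U l)) - wilsonBoundaryAction ρ {l} U))) :=
    hfc.mul hwc
  rw [integral_zdWilsonMeasure_eq_integral_integral_ymSpecification ρ hρ β (Δ := {l}) hl h1c,
    integral_zdWilsonMeasure_eq_integral_integral_ymSpecification ρ hρ β (Δ := {l}) hl h2c]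
  exact integral_congr_ae (ae_of_all _ fun η =>
    integral_shift_ymSpecification_singleton ρ l hρ β g η hfc.measurable)

/-- The same for `SO(N)`-type concrete groups packaged as a lattice representation: `zdWilsonMeasure r.ρ β Λ` is a
Haar-shift state at `l` (no separate second-countability hypothesis: the faithful `r.ρ` provides it). [folklore] -/
theorem isHaarShiftStateAt_zdWilsonMeasure_rep {G : Type} [Group G] [TopologicalSpace G] [IsTopologicalGroup G]
    [CompactSpace G] [MeasurableSpace G] [BorelSpace G] (r : LatticeRep G) (β : ℝ) (Λ : Finset (Site d))
    (l : ZdEdge d) (hl : ∀ p ∈ plaquettesTouching ({l} : Finset (ZdEdge d)),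
      ((p.1, p.2.1.1, p.2.1.2) : Site d × Fin d × Fin d) ∈ plaquettesIn Λ) :
    IsHaarShiftStateAt r.ρ β (zdWilsonMeasure r.ρ β Λ) l := by
  haveI : SecondCountableTopology G :=
    (r.continuous.isClosedEmbedding r.injective).isEmbedding.secondCountableTopology
  exact isHaarShiftStateAt_zdWilsonMeasure r.ρ r.continuous β Λ l hl

end Free

end Summit.QuantumFields.GaugeBoot
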